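import Summits.QuantumFields.YangMills.Theorems.ColdStartUniversalityLatticeLangevinDuhamel
import Summits.QuantumFields.YangMills.Theorems.ColdStartUniversalityLatticeLangevinGroundStateDynkin
import Summits.QuantumFields.YangMills.Theorems.ColdStartUniversalityLatticeLangevinTransitionRidge
import Mathlib.MeasureTheory.Integral.Prod
import HarnessLib

/-!
# Route `ColdStartUniversality`, crux K_A1 `UniformColdStartMixing` (stmt-QuantumFields-24809), rung `stub_fixedCutoffMixing`:
# (Inv) wall, step E — the integrated Duhamel identity for the SU(2) SZZ kernels

Helper file (seat `ym-line-csu-p1`, g8).  For Markov kernel families `κ` (coupling `β'`) and `κ⁰` (coupling `0`) realising the SZZ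
transition laws, the ground state `φ̂ = e^{-ψ̂/2}`, the weight `ρ = e^{ψ̂} = φ̂⁻²` (so `ρ · Haar^E ∝ μ_{β'}`), the potential `V̂` and a
ridge-form `w`:

  `m_t(φ̂ w) - m₀(φ̂ w) = ∫₀ᵗ [m₀(φ̂ V̂ κ⁰_r w) - m_{t-r}(φ̂ V̂ κ⁰_r w)] dr`,  `m_s(h) := ∫ (κ_s h) ρ dHaar^E`, `m₀(h) := ∫ h ρ dHaar^E`

(`integrated_duhamel`) — hypothesis `h5` of the abstract Picard step `integral_kernel_weighted_eq_of_duhamel`.  Ingredients: the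
pointwise Duhamel identity along the regular `β'`-flow (`groundState_duhamel`), Dynkin for `e^{ψ̂/2}` along the `β' = 0` flow
(`integral_exp_half_psi_beta_zero`), Haar symmetry of `κ⁰` (`integral_mul_transition_symm_beta_zero`), the ridge eigen-expansion
(`integral_ridge_transitionKernel_beta_zero`), two Fubini exchanges and the substitution `s = t - r`.  No definition, no sorry.
RECORD-rung R3 plumbing; nothing here bears on the mass gap.
-/

set_option autoImplicit false

noncomputable section

namespace Summit.QuantumFields.YangMills.Theorems.ColdStartUniversality

open MeasureTheory ProbabilityTheory Finset Filter Set
open scoped BigOperators NNReal ENNReal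
open Literature.Probability.Process Literature.MathematicalPhysics.QuantumFieldTheory Literature.Analysis.SpecialFunctions
open Literature.MathematicalPhysics.QuantumLattice (fundamentalRep fundamentalLatticeRep)

variable {L : ℕ} [NeZero L]

/-- **The integrated Duhamel identity.**  See the module docstring. [folklore] -/
theorem integrated_duhamel (β' : ℝ)
    (κ : ℝ≥0 → Kernel (GaugeConfig 3 L (Matrix.specialUnitaryGroup (Fin 2) ℂ))
      (GaugeConfig 3 L (Matrix.specialUnitaryGroup (Fin 2) ℂ))) [∀ t, IsMarkovKernel (κ t)]
    (hreal : ∀ (t : ℝ≥0) (x : GaugeConfig 3 L (Matrix.specialUnitaryGroup (Fin 2) ℂ))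
        (Ω : Type) [MeasurableSpace Ω] (P : Measure Ω) [IsProbabilityMeasure P]
        (W : ℝ≥0 → Ω → (Edge 3 L × NoiseIdx 2 → ℝ)) (hW : IsFlatBrownian W P)
        (U : ℝ≥0 → Ω → GaugeConfig 3 L (Matrix.specialUnitaryGroup (Fin 2) ℂ)),
        (∀ ω, U 0 ω = x) →
        (latticeLangevinDynamics (fundamentalLatticeRep 2) β').IsSolution (fundamentalRep (Fin 2))
          hW.natFiltration P W U →
        κ t x = P.map (U t))
    (κ₀ : ℝ≥0 → Kernel (GaugeConfig 3 L (Matrix.specialUnitaryGroup (Fin 2) ℂ))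
      (GaugeConfig 3 L (Matrix.specialUnitaryGroup (Fin 2) ℂ))) [∀ t, IsMarkovKernel (κ₀ t)]
    (hreal₀ : ∀ (t : ℝ≥0) (x : GaugeConfig 3 L (Matrix.specialUnitaryGroup (Fin 2) ℂ))
        (Ω : Type) [MeasurableSpace Ω] (P : Measure Ω) [IsProbabilityMeasure P]
        (W : ℝ≥0 → Ω → (Edge 3 L × NoiseIdx 2 → ℝ)) (hW : IsFlatBrownian W P)
        (U : ℝ≥0 → Ω → GaugeConfig 3 L (Matrix.specialUnitaryGroup (Fin 2) ℂ)),
        (∀ ω, U 0 ω = x) →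
        (latticeLangevinDynamics (fundamentalLatticeRep 2) 0).IsSolution (fundamentalRep (Fin 2))
          hW.natFiltration P W U →
        κ₀ t x = P.map (U t))
    {ι : Type} [Fintype ι] (c : ι → ℝ) (g : ι → Edge 3 L → Matrix.specialUnitaryGroup (Fin 2) ℂ) (m : ι → Edge 3 L → ℕ)
    (t : ℝ≥0) :
    let ψV : GaugeConfig 3 L (Matrix.specialUnitaryGroup (Fin 2) ℂ) → ℝ := fun V =>
      β' * ∑ p : Plaquette 3 L, (rootedLoop (fun (e : Edge 3 L) (i j : Fin 2) =>
        ((((fundamentalRep (Fin 2) (V e) : Matrix (Fin 2) (Fin 2) ℂ) i j).re : ℝ) : ℂ) +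
          ((((fundamentalRep (Fin 2) (V e) : Matrix (Fin 2) (Fin 2) ℂ) i j).im : ℝ) : ℂ) * Complex.I)
        (p.1, p.2.1.1) p.2.1.2 false).trace.re
    let Vh : GaugeConfig 3 L (Matrix.specialUnitaryGroup (Fin 2) ℂ) → ℝ := fun V =>
      (let x : (Edge 3 L × Fin 2 × Fin 2 × Bool) → ℝ := fun q =>
          (fun z : ℂ => if q.2.2.2 then z.im else z.re)
            ((fundamentalRep (Fin 2) (V q.1) : Matrix (Fin 2) (Fin 2) ℂ) q.2.1 q.2.2.1)
       let b₀ : (Edge 3 L × Fin 2 × Fin 2 × Bool) → ℝ := fun q =>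
          (fun z : ℂ => if q.2.2.2 then z.im else z.re) ((latticeLangevinDynamics (fundamentalLatticeRep 2) 0).drift
            (matrixConfig (fundamentalRep (Fin 2)) V) q.1 q.2.1 q.2.2.1)
       let σ : (Edge 3 L × Fin 2 × Fin 2 × Bool) → (Edge 3 L × NoiseIdx 2) → ℝ := fun q k =>
          if k.1 = q.1 then (fun z : ℂ => if q.2.2.2 then z.im else z.re)
            ((latticeLangevinDynamics (fundamentalLatticeRep 2) 0).noise
              (matrixConfig (fundamentalRep (Fin 2)) V) q.1 k.2 q.2.1 q.2.2.1) else 0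
       let ψ : ((Edge 3 L × Fin 2 × Fin 2 × Bool) → ℝ) → ℝ := fun y =>
          β' * ∑ p : Plaquette 3 L, (rootedLoop (fun (e : Edge 3 L) (i j : Fin 2) =>
            ((y (e, i, j, false) : ℝ) : ℂ) + ((y (e, i, j, true) : ℝ) : ℂ) * Complex.I) (p.1, p.2.1.1) p.2.1.2 false).trace.re
       1 / 2 * (∑ i, fderiv ℝ ψ x (Pi.single i 1) * b₀ i +
            1 / 2 * ∑ i, ∑ j, fderiv ℝ (fun z => fderiv ℝ ψ z (Pi.single i 1)) x (Pi.single j 1) * ∑ n, σ i n * σ j n) +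
          1 / 8 * ∑ i, ∑ j, fderiv ℝ ψ x (Pi.single i 1) * fderiv ℝ ψ x (Pi.single j 1) * ∑ n, σ i n * σ j n)
    let φ : GaugeConfig 3 L (Matrix.specialUnitaryGroup (Fin 2) ℂ) → ℝ := fun V => Real.exp (-(1 / 2 : ℝ) * ψV V)
    let ρ : GaugeConfig 3 L (Matrix.specialUnitaryGroup (Fin 2) ℂ) → ℝ := fun V => Real.exp (ψV V)
    let w : GaugeConfig 3 L (Matrix.specialUnitaryGroup (Fin 2) ℂ) → ℝ := fun V =>
      ∑ l, c l * ∏ e, gegenbauerSum 1 (m l e) (hsForm 2 (fundamentalRep (Fin 2) (g l e)) (fundamentalRep (Fin 2) (V e)) / 2)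
    (∫ x, (∫ y, φ y * w y ∂(κ t x)) * ρ x
        ∂(Measure.pi fun _ : Edge 3 L => haarProbability (Matrix.specialUnitaryGroup (Fin 2) ℂ))) -
      ∫ x, φ x * w x * ρ x ∂(Measure.pi fun _ : Edge 3 L => haarProbability (Matrix.specialUnitaryGroup (Fin 2) ℂ)) =
    ∫ r in (0 : ℝ)..(t : ℝ),
      ((∫ x, φ x * Vh x * (∫ y, w y ∂(κ₀ r.toNNReal x)) * ρ x
          ∂(Measure.pi fun _ : Edge 3 L => haarProbability (Matrix.specialUnitaryGroup (Fin 2) ℂ))) -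
        ∫ x, (∫ y, φ y * Vh y * (∫ z, w z ∂(κ₀ r.toNNReal y)) ∂(κ ((t : ℝ) - r).toNNReal x)) * ρ x
          ∂(Measure.pi fun _ : Edge 3 L => haarProbability (Matrix.specialUnitaryGroup (Fin 2) ℂ))) := by
  intro ψV Vh φ ρ w
  classical
  haveI := secondCountableTopology_su2
  haveI := borelSpace_config L
  haveI : IsProbabilityMeasure (haarProbability (Matrix.specialUnitaryGroup (Fin 2) ℂ)) := inferInstance
  set π : Measure (GaugeConfig 3 L (Matrix.specialUnitaryGroup (Fin 2) ℂ)) :=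
    Measure.pi fun _ : Edge 3 L => haarProbability (Matrix.specialUnitaryGroup (Fin 2) ℂ) with hπ
  haveI : IsProbabilityMeasure π := by rw [hπ]; infer_instance
  set Tw : ℝ → GaugeConfig 3 L (Matrix.specialUnitaryGroup (Fin 2) ℂ) → ℝ := fun τ V =>
      ∑ l, c l * Real.exp (-(∑ e, (m l e : ℝ) * ((m l e : ℝ) + 2) / 2) * τ) *
        ∏ e, gegenbauerSum 1 (m l e) (hsForm 2 (fundamentalRep (Fin 2) (g l e)) (fundamentalRep (Fin 2) (V e)) / 2) with hTw
  set φi : GaugeConfig 3 L (Matrix.specialUnitaryGroup (Fin 2) ℂ) → ℝ := fun V => Real.exp ((1 / 2 : ℝ) * ψV V) with hφi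
  obtain ⟨-, -, hψc, -⟩ := exists_groundState_bounds (L := L) β'
  have hψVc : Continuous ψV := hψc
  have hφc : Continuous φ := Real.continuous_exp.comp (continuous_const.mul hψVc)
  have hρc : Continuous ρ := Real.continuous_exp.comp hψVc
  have hφic : Continuous φi := Real.continuous_exp.comp (continuous_const.mul hψVc)
  have hVc : Continuous Vh := continuous_groundStatePotential (L := L) β'
  have hFl : ∀ l, Continuous fun V : GaugeConfig 3 L (Matrix.specialUnitaryGroup (Fin 2) ℂ) =>
      ∏ e, gegenbauerSum 1 (m l e) (hsForm 2 (fundamentalRep (Fin 2) (g l e)) (fundamentalRep (Fin 2) (V e)) / 2) := fun l =>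
    continuous_prod_gegenbauer_latitude (L := L) (g l) (m l)
  have hwc : Continuous w := continuous_finsetSum _ fun l _ => continuous_const.mul (hFl l)
  have hTwc : ∀ τ, Continuous (Tw τ) := fun τ => continuous_finsetSum _ fun l _ => continuous_const.mul (hFl l)
  have hφρ : ∀ V, φ V * ρ V = φi V := fun V => by
    show Real.exp (-(1 / 2 : ℝ) * ψV V) * Real.exp (ψV V) = Real.exp ((1 / 2 : ℝ) * ψV V)
    rw [← Real.exp_add]; congr 1; ring
  have hTw0 : ∀ V, Tw 0 V = w V := fun V => by
    simp only [hTw, mul_zero, Real.exp_zero, mul_one]; rfl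
  haveI := isProbabilityMeasure_piWiener (Edge 3 L × NoiseIdx 2)
  have hWc := isFlatBrownian_piWiener 3 L (NoiseIdx 2)
  obtain ⟨X, GX, hX, hXm, -, -, -⟩ := exists_regularFlow L β' hWc
  obtain ⟨Y, GY, hY, hYm, -, -, -⟩ := exists_regularFlow L 0 hWc
  have hPX : ∀ (s : ℝ≥0) (x : GaugeConfig 3 L (Matrix.specialUnitaryGroup (Fin 2) ℂ))
      {F : GaugeConfig 3 L (Matrix.specialUnitaryGroup (Fin 2) ℂ) → ℝ}, Continuous F →
      ∫ y, F y ∂(κ s x) = ∫ ω, F (X x s ω) ∂(Measure.pi fun _ : Edge 3 L × NoiseIdx 2 => preWienerMeasure) := by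
    intro s x F hF
    have hm : Measurable (X x s) := ((hX x).2.adapted s).mono (hWc.natFiltration.le s) le_rfl
    rw [hreal s x _ _ _ hWc (X x) (hX x).1 (hX x).2, integral_map hm.aemeasurable hF.aestronglyMeasurable]
  have hPY : ∀ (s : ℝ≥0) (x : GaugeConfig 3 L (Matrix.specialUnitaryGroup (Fin 2) ℂ))
      {F : GaugeConfig 3 L (Matrix.specialUnitaryGroup (Fin 2) ℂ) → ℝ}, Continuous F →
      ∫ y, F y ∂(κ₀ s x) = ∫ ω, F (Y x s ω) ∂(Measure.pi fun _ : Edge 3 L × NoiseIdx 2 => preWienerMeasure) := by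
    intro s x F hF
    have hm : Measurable (Y x s) := ((hY x).2.adapted s).mono (hWc.natFiltration.le s) le_rfl
    rw [hreal₀ s x _ _ _ hWc (Y x) (hY x).1 (hY x).2, integral_map hm.aemeasurable hF.aestronglyMeasurable]
  -- the ridge eigen-expansion: `κ⁰_τ w = Tw τ`
  have hTwκ : ∀ (τ : ℝ≥0) (x : GaugeConfig 3 L (Matrix.specialUnitaryGroup (Fin 2) ℂ)), ∫ y, w y ∂(κ₀ τ x) = Tw τ x :=
    fun τ x => integral_ridge_transitionKernel_beta_zero κ₀ hreal₀ c g m τ x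
  have hbdd : ∀ {f : GaugeConfig 3 L (Matrix.specialUnitaryGroup (Fin 2) ℂ) → ℝ}, Continuous f →
      ∃ M : ℝ, 0 ≤ M ∧ ∀ x, |f x| ≤ M := fun hf => exists_abs_le_of_continuous hf
  obtain ⟨Mφ, hMφ0, hMφ⟩ := hbdd hφc
  obtain ⟨Mρ, hMρ0, hMρ⟩ := hbdd hρc
  obtain ⟨Mφi, -, hMφi⟩ := hbdd hφic
  obtain ⟨Mw, hMw0, hMw⟩ := hbdd hwc
  obtain ⟨KV, hKV0, hKV⟩ := hbdd hVc
  have hker_bd : ∀ (η : Kernel (GaugeConfig 3 L (Matrix.specialUnitaryGroup (Fin 2) ℂ))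
      (GaugeConfig 3 L (Matrix.specialUnitaryGroup (Fin 2) ℂ))) [IsMarkovKernel η]
      {f : GaugeConfig 3 L (Matrix.specialUnitaryGroup (Fin 2) ℂ) → ℝ} {Mf : ℝ}, (∀ y, |f y| ≤ Mf) →
      ∀ x, |∫ y, f y ∂(η x)| ≤ Mf := by
    intro η _ f Mf hf x
    have h := norm_integral_le_of_norm_le_const (μ := η x) (f := f) (C := Mf)
      (Eventually.of_forall fun y => by rw [Real.norm_eq_abs]; exact hf y)
    rwa [Real.norm_eq_abs, probReal_univ, mul_one] at h
  have hker_sm : ∀ (η : Kernel (GaugeConfig 3 L (Matrix.specialUnitaryGroup (Fin 2) ℂ))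
      (GaugeConfig 3 L (Matrix.specialUnitaryGroup (Fin 2) ℂ)))
      {f : GaugeConfig 3 L (Matrix.specialUnitaryGroup (Fin 2) ℂ) → ℝ}, Continuous f →
      StronglyMeasurable fun x => ∫ y, f y ∂(η x) := fun η f hf => hf.stronglyMeasurable.integral_kernel
  have hint : ∀ {f : GaugeConfig 3 L (Matrix.specialUnitaryGroup (Fin 2) ℂ) → ℝ}, Continuous f →
      ∀ (ν : Measure (GaugeConfig 3 L (Matrix.specialUnitaryGroup (Fin 2) ℂ))) [IsProbabilityMeasure ν], Integrable f ν := by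
    intro f hf ν _
    obtain ⟨C, -, hC⟩ := hbdd hf
    exact Integrable.of_bound hf.aestronglyMeasurable C (Eventually.of_forall fun y => by rw [Real.norm_eq_abs]; exact hC y)
  have hintκ : ∀ (η : Kernel (GaugeConfig 3 L (Matrix.specialUnitaryGroup (Fin 2) ℂ))
      (GaugeConfig 3 L (Matrix.specialUnitaryGroup (Fin 2) ℂ))) [IsMarkovKernel η]
      {f : GaugeConfig 3 L (Matrix.specialUnitaryGroup (Fin 2) ℂ) → ℝ}, Continuous f →
      ∀ {h : GaugeConfig 3 L (Matrix.specialUnitaryGroup (Fin 2) ℂ) → ℝ}, Continuous h →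
      Integrable (fun x => (∫ y, f y ∂(η x)) * h x) π := by
    intro η _ f hf h hh
    obtain ⟨Mf, -, hMf⟩ := hbdd hf
    obtain ⟨Mh, -, hMh⟩ := hbdd hh
    refine Integrable.of_bound ((hker_sm η hf).mul hh.stronglyMeasurable).aestronglyMeasurable (Mf * Mh)
      (Eventually.of_forall fun x => ?_)
    rw [Real.norm_eq_abs, abs_mul]
    exact mul_le_mul (hker_bd η hMf x) (hMh x) (abs_nonneg _) ((abs_nonneg _).trans (hker_bd η hMf x))
  -- ### step A along the `β'`-flow
  have hA : ∀ x : GaugeConfig 3 L (Matrix.specialUnitaryGroup (Fin 2) ℂ),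
      Continuous (fun s : ℝ => ∫ ω, φ (X x s.toNNReal ω) * (Vh (X x s.toNNReal ω) * Tw ((t : ℝ) - s) (X x s.toNNReal ω))
        ∂(Measure.pi fun _ : Edge 3 L × NoiseIdx 2 => preWienerMeasure)) ∧
      ∫ ω, φ (X x t ω) * Tw 0 (X x t ω) ∂(Measure.pi fun _ : Edge 3 L × NoiseIdx 2 => preWienerMeasure) =
        φ x * Tw t x - ∫ s in (0 : ℝ)..(t : ℝ), ∫ ω, φ (X x s.toNNReal ω) *
          (Vh (X x s.toNNReal ω) * Tw ((t : ℝ) - s) (X x s.toNNReal ω))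
            ∂(Measure.pi fun _ : Edge 3 L × NoiseIdx 2 => preWienerMeasure) := by
    intro x
    have h := groundState_duhamel (L := L) β' hWc X hX hXm c g m x t
    exact h
  -- ### step C along the `0`-flow
  have hC : ∀ x : GaugeConfig 3 L (Matrix.specialUnitaryGroup (Fin 2) ℂ),
      Continuous (fun r : ℝ => ∫ ω, Vh (Y x r.toNNReal ω) * φi (Y x r.toNNReal ω)
        ∂(Measure.pi fun _ : Edge 3 L × NoiseIdx 2 => preWienerMeasure)) ∧
      ∀ τ : ℝ, 0 ≤ τ → ∫ ω, φi (Y x τ.toNNReal ω) ∂(Measure.pi fun _ : Edge 3 L × NoiseIdx 2 => preWienerMeasure) =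
        φi x + ∫ r in (0 : ℝ)..τ, ∫ ω, Vh (Y x r.toNNReal ω) * φi (Y x r.toNNReal ω)
          ∂(Measure.pi fun _ : Edge 3 L × NoiseIdx 2 => preWienerMeasure) := by
    intro x
    have h := integral_exp_half_psi_beta_zero (L := L) β' hWc Y hY hYm x
    exact h
  have ht0 : (0 : ℝ) ≤ t := t.2
  have htt : ((t : ℝ)).toNNReal = t := Real.toNNReal_coe
  -- ### the left-hand side: `m_t(φ w) = ∫ φ ρ T_t w dπ - ∫ I ρ dπ`
  set I : GaugeConfig 3 L (Matrix.specialUnitaryGroup (Fin 2) ℂ) → ℝ := fun x =>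
    ∫ s in (0 : ℝ)..(t : ℝ), ∫ ω, φ (X x s.toNNReal ω) * (Vh (X x s.toNNReal ω) * Tw ((t : ℝ) - s) (X x s.toNNReal ω))
      ∂(Measure.pi fun _ : Edge 3 L × NoiseIdx 2 => preWienerMeasure) with hI
  have e1 : ∀ x, ∫ y, φ y * w y ∂(κ t x) = φ x * Tw t x - I x := by
    intro x
    rw [hPX t x (F := fun y => φ y * w y) (hφc.mul hwc)]
    have h2 : ∫ ω, φ (X x t ω) * w (X x t ω) ∂(Measure.pi fun _ : Edge 3 L × NoiseIdx 2 => preWienerMeasure) =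
        ∫ ω, φ (X x t ω) * Tw 0 (X x t ω) ∂(Measure.pi fun _ : Edge 3 L × NoiseIdx 2 => preWienerMeasure) :=
      integral_congr_ae (Eventually.of_forall fun ω => by simp only [hTw0])
    rw [h2, (hA x).2]
  have hint1 : Integrable (fun x => φ x * Tw t x * ρ x) π := hint ((hφc.mul (hTwc _)).mul hρc) π
  have hintI : Integrable (fun x => I x * ρ x) π := by
    have h : (fun x => I x * ρ x) = fun x => φ x * Tw t x * ρ x - (∫ y, φ y * w y ∂(κ t x)) * ρ x := by
      funext x; rw [e1]; ring
    rw [h]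
    exact hint1.sub (hintκ (κ t) (hφc.mul hwc) hρc)
  have eL : ∫ x, (∫ y, φ y * w y ∂(κ t x)) * ρ x ∂π = (∫ x, φi x * Tw t x ∂π) - ∫ x, I x * ρ x ∂π := by
    have h : (fun x => (∫ y, φ y * w y ∂(κ t x)) * ρ x) = fun x => φ x * Tw t x * ρ x - I x * ρ x := by
      funext x; rw [e1]; ring
    rw [h, integral_sub hint1 hintI]
    congr 1
    exact integral_congr_ae (Eventually.of_forall fun x => by
      show φ x * Tw t x * ρ x = φi x * Tw t x
      rw [← hφρ]; ring)
  -- ### Fubini for `∫ I ρ dπ`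
  set Gs : ℝ → GaugeConfig 3 L (Matrix.specialUnitaryGroup (Fin 2) ℂ) → ℝ := fun s V =>
    φ V * (Vh V * Tw ((t : ℝ) - s) V) with hGs
  have hGsc : ∀ s, Continuous (Gs s) := fun s => hφc.mul (hVc.mul (hTwc _))
  set u : ℝ → GaugeConfig 3 L (Matrix.specialUnitaryGroup (Fin 2) ℂ) → ℝ := fun s x =>
    ∫ ω, Gs s (X x s.toNNReal ω) ∂(Measure.pi fun _ : Edge 3 L × NoiseIdx 2 => preWienerMeasure) with hu
  have hu_eq : ∀ s x, u s x = ∫ y, Gs s y ∂(κ s.toNNReal x) := fun s x => (hPX _ x (hGsc s)).symm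
  have hu_cont : ∀ x, Continuous fun s => u s x := fun x => (hA x).1
  have hu_meas : ∀ s, Measurable (u s) := fun s => by
    have h : u s = fun x => ∫ y, Gs s y ∂(κ s.toNNReal x) := funext (hu_eq s)
    rw [h]; exact (hker_sm (κ s.toNNReal) (hGsc s)).measurable
  have hum : Measurable (Function.uncurry u) := measurable_uncurry_of_continuous_of_measurable hu_cont hu_meas
  -- bound on `[0, t]`: there `Tw (t - s) = κ⁰_{t-s} w` is a kernel average of `w`
  have hTw_bd : ∀ s ∈ Icc (0 : ℝ) t, ∀ V, |Tw ((t : ℝ) - s) V| ≤ Mw := by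
    intro s hs V
    have hts : (((t : ℝ) - s).toNNReal : ℝ) = (t : ℝ) - s := Real.coe_toNNReal _ (sub_nonneg.2 hs.2)
    rw [← hts, ← hTwκ]
    exact hker_bd (κ₀ _) hMw V
  have hGs_bd : ∀ s ∈ Icc (0 : ℝ) t, ∀ V, |Gs s V| ≤ Mφ * (KV * Mw) := by
    intro s hs V
    simp only [hGs, abs_mul]
    exact mul_le_mul (hMφ V) (mul_le_mul (hKV V) (hTw_bd s hs V) (abs_nonneg _) hKV0) (by positivity) hMφ0
  have hu_bd : ∀ s ∈ Icc (0 : ℝ) t, ∀ x, |u s x| ≤ Mφ * (KV * Mw) := by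
    intro s hs x
    have h := norm_integral_le_of_norm_le_const (μ := (Measure.pi fun _ : Edge 3 L × NoiseIdx 2 => preWienerMeasure))
      (f := fun ω => Gs s (X x s.toNNReal ω)) (C := Mφ * (KV * Mw))
      (Eventually.of_forall fun ω => by rw [Real.norm_eq_abs]; exact hGs_bd s hs _)
    rwa [Real.norm_eq_abs, probReal_univ, mul_one] at h
  set ν : Measure ℝ := volume.restrict (Ioc (0 : ℝ) t) with hν
  haveI : IsFiniteMeasure ν := by rw [hν]; infer_instance
  have hae1 : ∀ᵐ p ∂(π.prod ν), p ∈ {p : GaugeConfig 3 L (Matrix.specialUnitaryGroup (Fin 2) ℂ) × ℝ | p.2 ∈ Ioc (0 : ℝ) t} := by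
    have hs : MeasurableSet {p : GaugeConfig 3 L (Matrix.specialUnitaryGroup (Fin 2) ℂ) × ℝ | p.2 ∈ Ioc (0 : ℝ) t} :=
      measurableSet_Ioc.preimage measurable_snd
    rw [Measure.ae_prod_mem_iff_ae_ae_mem hs]
    exact Eventually.of_forall fun x => by rw [hν]; exact ae_restrict_mem measurableSet_Ioc
  have hF1 : Integrable (fun p : GaugeConfig 3 L (Matrix.specialUnitaryGroup (Fin 2) ℂ) × ℝ => u p.2 p.1 * ρ p.1) (π.prod ν) := by
    refine Integrable.of_bound ?_ (Mφ * (KV * Mw) * Mρ) ?_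
    · exact ((hum.comp measurable_swap).mul (hρc.measurable.comp measurable_fst)).aestronglyMeasurable
    · filter_upwards [hae1] with p hp
      have hp' : p.2 ∈ Ioc (0 : ℝ) t := hp
      rw [Real.norm_eq_abs, abs_mul]
      exact mul_le_mul (hu_bd p.2 ⟨hp'.1.le, hp'.2⟩ p.1) (hMρ p.1) (abs_nonneg _) (by positivity)
  have eI : ∫ x, I x * ρ x ∂π = ∫ s in (0 : ℝ)..(t : ℝ), ∫ x, u s x * ρ x ∂π := by
    have h1 : (fun x => I x * ρ x) = fun x => ∫ s in Ioc (0 : ℝ) t, u s x * ρ x := by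
      funext x
      rw [hI]; dsimp only
      rw [intervalIntegral.integral_of_le ht0, ← integral_mul_const]
    rw [h1, intervalIntegral.integral_of_le ht0]
    exact integral_integral_swap hF1
  have eI2 : ∀ s, ∫ x, u s x * ρ x ∂π = ∫ x, (∫ y, Gs s y ∂(κ s.toNNReal x)) * ρ x ∂π := fun s =>
    integral_congr_ae (Eventually.of_forall fun x => by simp only [hu_eq])
  -- substitution `s = t - r`
  have eI3 : ∫ s in (0 : ℝ)..(t : ℝ), ∫ x, (∫ y, Gs s y ∂(κ s.toNNReal x)) * ρ x ∂π =
      ∫ r in (0 : ℝ)..(t : ℝ), ∫ x, (∫ y, Gs ((t : ℝ) - r) y ∂(κ ((t : ℝ) - r).toNNReal x)) * ρ x ∂π := by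
    have h := intervalIntegral.integral_comp_sub_left
      (fun s => ∫ x, (∫ y, Gs s y ∂(κ s.toNNReal x)) * ρ x ∂π) (t : ℝ) (a := 0) (b := (t : ℝ))
    simp only [sub_self, sub_zero] at h
    exact h.symm
  -- ### the first term: symmetry, Dynkin for `φ⁻¹`, Fubini, symmetry
  have eT1 : ∫ x, φi x * Tw t x ∂π = ∫ x, w x * ∫ y, φi y ∂(κ₀ t x) ∂π := by
    have h1 : ∫ x, φi x * Tw t x ∂π = ∫ x, φi x * ∫ y, w y ∂(κ₀ t x) ∂π :=
      integral_congr_ae (Eventually.of_forall fun x => by simp only [hTwκ])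
    rw [h1, hπ]
    exact integral_mul_transition_symm_beta_zero κ₀ hreal₀ t hφic hwc
  set J : GaugeConfig 3 L (Matrix.specialUnitaryGroup (Fin 2) ℂ) → ℝ := fun x =>
    ∫ r in (0 : ℝ)..(t : ℝ), ∫ ω, Vh (Y x r.toNNReal ω) * φi (Y x r.toNNReal ω)
      ∂(Measure.pi fun _ : Edge 3 L × NoiseIdx 2 => preWienerMeasure) with hJ
  have eC : ∀ x, ∫ y, φi y ∂(κ₀ t x) = φi x + J x := by
    intro x
    rw [hPY t x hφic]
    have h := (hC x).2 (t : ℝ) ht0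
    rw [htt] at h
    exact h
  have hintJ : Integrable (fun x => w x * J x) π := by
    have h : (fun x => w x * J x) = fun x => (∫ y, φi y ∂(κ₀ t x)) * w x - w x * φi x := by
      funext x; rw [eC]; ring
    rw [h]
    exact (hintκ (κ₀ t) hφic hwc).sub (hint (hwc.mul hφic) π)
  have eT2 : ∫ x, w x * ∫ y, φi y ∂(κ₀ t x) ∂π = (∫ x, w x * φi x ∂π) + ∫ x, w x * J x ∂π := by
    have h : (fun x => w x * ∫ y, φi y ∂(κ₀ t x)) = fun x => w x * φi x + w x * J x :=
      funext fun x => by rw [eC, mul_add]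
    rw [h, integral_add (hint (f := fun x => w x * φi x) (hwc.mul hφic) π) hintJ]
  -- Fubini for `∫ w J dπ`
  set u₂ : ℝ → GaugeConfig 3 L (Matrix.specialUnitaryGroup (Fin 2) ℂ) → ℝ := fun r x =>
    ∫ ω, Vh (Y x r.toNNReal ω) * φi (Y x r.toNNReal ω) ∂(Measure.pi fun _ : Edge 3 L × NoiseIdx 2 => preWienerMeasure) with hu₂
  have hu₂_eq : ∀ r x, u₂ r x = ∫ y, Vh y * φi y ∂(κ₀ r.toNNReal x) := fun r x => (hPY _ x (hVc.mul hφic)).symm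
  have hu₂_cont : ∀ x, Continuous fun r => u₂ r x := fun x => (hC x).1
  have hu₂_meas : ∀ r, Measurable (u₂ r) := fun r => by
    have h : u₂ r = fun x => ∫ y, Vh y * φi y ∂(κ₀ r.toNNReal x) := funext (hu₂_eq r)
    rw [h]; exact (hker_sm (κ₀ r.toNNReal) (hVc.mul hφic)).measurable
  have hum₂ : Measurable (Function.uncurry u₂) := measurable_uncurry_of_continuous_of_measurable hu₂_cont hu₂_meas
  have hVφi_bd : ∀ y, |Vh y * φi y| ≤ KV * Mφi := fun y => by
    rw [abs_mul]; exact mul_le_mul (hKV y) (hMφi y) (abs_nonneg _) hKV0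
  have hu₂_bd : ∀ r x, |u₂ r x| ≤ KV * Mφi := fun r x => by
    rw [hu₂_eq]; exact hker_bd (κ₀ _) hVφi_bd x
  have hF2 : Integrable (fun p : GaugeConfig 3 L (Matrix.specialUnitaryGroup (Fin 2) ℂ) × ℝ => w p.1 * u₂ p.2 p.1) (π.prod ν) := by
    refine Integrable.of_bound ?_ (Mw * (KV * Mφi)) (Eventually.of_forall fun p => ?_)
    · exact ((hwc.measurable.comp measurable_fst).mul (hum₂.comp measurable_swap)).aestronglyMeasurable
    · rw [Real.norm_eq_abs, abs_mul]
      exact mul_le_mul (hMw p.1) (hu₂_bd p.2 p.1) (abs_nonneg _) hMw0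
  have eJ : ∫ x, w x * J x ∂π = ∫ r in (0 : ℝ)..(t : ℝ), ∫ x, w x * u₂ r x ∂π := by
    have h1 : (fun x => w x * J x) = fun x => ∫ r in Ioc (0 : ℝ) t, w x * u₂ r x := by
      funext x
      rw [hJ]; dsimp only
      rw [intervalIntegral.integral_of_le ht0, ← integral_const_mul]
    rw [h1, intervalIntegral.integral_of_le ht0]
    exact integral_integral_swap hF2
  have eJ2 : ∀ r : ℝ, ∫ x, w x * u₂ r x ∂π = ∫ x, φ x * Vh x * (∫ y, w y ∂(κ₀ r.toNNReal x)) * ρ x ∂π := by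
    intro r
    have h1 : ∫ x, w x * u₂ r x ∂π = ∫ x, w x * ∫ y, Vh y * φi y ∂(κ₀ r.toNNReal x) ∂π :=
      integral_congr_ae (Eventually.of_forall fun x => by simp only [hu₂_eq])
    have h2 : ∫ x, w x * ∫ y, Vh y * φi y ∂(κ₀ r.toNNReal x) ∂π = ∫ x, (Vh x * φi x) * ∫ y, w y ∂(κ₀ r.toNNReal x) ∂π := by
      rw [hπ]; exact integral_mul_transition_symm_beta_zero κ₀ hreal₀ _ hwc (hVc.mul hφic)
    rw [h1, h2]
    exact integral_congr_ae (Eventually.of_forall fun x => by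
      show Vh x * φi x * ∫ y, w y ∂(κ₀ r.toNNReal x) = φ x * Vh x * (∫ y, w y ∂(κ₀ r.toNNReal x)) * ρ x
      rw [← hφρ]; ring)
  -- ### interval integrability of the two `dr`-integrands
  have hAi : IntervalIntegrable (fun r : ℝ => ∫ x, φ x * Vh x * (∫ y, w y ∂(κ₀ r.toNNReal x)) * ρ x ∂π) volume 0 t := by
    have h : (fun r : ℝ => ∫ x, φ x * Vh x * (∫ y, w y ∂(κ₀ r.toNNReal x)) * ρ x ∂π) = fun r => ∫ x, w x * u₂ r x ∂π :=
      funext fun r => (eJ2 r).symm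
    rw [h, intervalIntegrable_iff_integrableOn_Ioc_of_le ht0]
    exact hF2.integral_prod_right
  have hBi : IntervalIntegrable (fun r : ℝ => ∫ x, (∫ y, Gs ((t : ℝ) - r) y ∂(κ ((t : ℝ) - r).toNNReal x)) * ρ x ∂π)
      volume 0 t := by
    have h1 : IntervalIntegrable (fun s : ℝ => ∫ x, (∫ y, Gs s y ∂(κ s.toNNReal x)) * ρ x ∂π) volume 0 t := by
      have h : (fun s : ℝ => ∫ x, (∫ y, Gs s y ∂(κ s.toNNReal x)) * ρ x ∂π) = fun s => ∫ x, u s x * ρ x ∂π :=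
        funext fun s => (eI2 s).symm
      rw [h, intervalIntegrable_iff_integrableOn_Ioc_of_le ht0]
      exact hF1.integral_prod_right
    have h2 := h1.comp_sub_left (t : ℝ)
    simp only [sub_zero, sub_self] at h2
    exact h2.symm
  -- ### assembly
  have e0 : ∫ x, φ x * w x * ρ x ∂π = ∫ x, w x * φi x ∂π :=
    integral_congr_ae (Eventually.of_forall fun x => by
      show φ x * w x * ρ x = w x * φi x
      rw [← hφρ]; ring)
  have eIall : ∫ x, I x * ρ x ∂π =
      ∫ r in (0 : ℝ)..(t : ℝ), ∫ x, (∫ y, Gs ((t : ℝ) - r) y ∂(κ ((t : ℝ) - r).toNNReal x)) * ρ x ∂π := by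
    rw [eI, ← eI3]
    exact intervalIntegral.integral_congr fun s _ => eI2 s
  have eTall : ∫ x, φi x * Tw t x ∂π =
      (∫ x, w x * φi x ∂π) + ∫ r in (0 : ℝ)..(t : ℝ), ∫ x, φ x * Vh x * (∫ y, w y ∂(κ₀ r.toNNReal x)) * ρ x ∂π := by
    rw [eT1, eT2, eJ]
    congr 1
    exact intervalIntegral.integral_congr fun r _ => eJ2 r
  show (∫ x, (∫ y, φ y * w y ∂(κ t x)) * ρ x ∂π) - ∫ x, φ x * w x * ρ x ∂π =
    ∫ r in (0 : ℝ)..(t : ℝ), ((∫ x, φ x * Vh x * (∫ y, w y ∂(κ₀ r.toNNReal x)) * ρ x ∂π) -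
      ∫ x, (∫ y, φ y * Vh y * (∫ z, w z ∂(κ₀ r.toNNReal y)) ∂(κ ((t : ℝ) - r).toNNReal x)) * ρ x ∂π)
  rw [eL, eIall, eTall, e0]
  have hsub := intervalIntegral.integral_sub hAi hBi
  rw [show (∫ x, w x * φi x ∂π) + (∫ r in (0 : ℝ)..(t : ℝ), ∫ x, φ x * Vh x * (∫ y, w y ∂(κ₀ r.toNNReal x)) * ρ x ∂π) -
      (∫ r in (0 : ℝ)..(t : ℝ), ∫ x, (∫ y, Gs ((t : ℝ) - r) y ∂(κ ((t : ℝ) - r).toNNReal x)) * ρ x ∂π) -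
      ∫ x, w x * φi x ∂π =
      (∫ r in (0 : ℝ)..(t : ℝ), ∫ x, φ x * Vh x * (∫ y, w y ∂(κ₀ r.toNNReal x)) * ρ x ∂π) -
      ∫ r in (0 : ℝ)..(t : ℝ), ∫ x, (∫ y, Gs ((t : ℝ) - r) y ∂(κ ((t : ℝ) - r).toNNReal x)) * ρ x ∂π by ring, ← hsub]
  refine intervalIntegral.integral_congr fun r hr => ?_
  rw [uIcc_of_le ht0] at hr
  have hrr : ((r.toNNReal : ℝ≥0) : ℝ) = r := Real.coe_toNNReal r hr.1
  have hin : ∀ x, ∫ y, Gs ((t : ℝ) - r) y ∂(κ ((t : ℝ) - r).toNNReal x) =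
      ∫ y, φ y * Vh y * (∫ z, w z ∂(κ₀ r.toNNReal y)) ∂(κ ((t : ℝ) - r).toNNReal x) := fun x =>
    integral_congr_ae (Eventually.of_forall fun y => by
      show φ y * (Vh y * Tw ((t : ℝ) - ((t : ℝ) - r)) y) = φ y * Vh y * ∫ z, w z ∂(κ₀ r.toNNReal y)
      rw [sub_sub_cancel, hTwκ, hrr]; ring)
  have hB : ∫ x, (∫ y, Gs ((t : ℝ) - r) y ∂(κ ((t : ℝ) - r).toNNReal x)) * ρ x ∂π =
      ∫ x, (∫ y, φ y * Vh y * (∫ z, w z ∂(κ₀ r.toNNReal y)) ∂(κ ((t : ℝ) - r).toNNReal x)) * ρ x ∂π :=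
    integral_congr_ae (Eventually.of_forall fun x => by simp only [hin])
  simp only [hB]

end Summit.QuantumFields.YangMills.Theorems.ColdStartUniversality

end
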